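import Summits.ResolutionOfSingularities.ResolutionOfSingularities.Theorems.ChainW52TargetsF7BetaRP
import HarnessLib

/-!
# Crux `PatchingRelPerfect` (stmt-ResolutionOfSingularities-16161), chain W5.2 — F7(β) (β-AX) X3 C-I (M0): the MEMBER-HIT
# clause of the reachability atlas, part 1 — statement of record, generation 1, and the reduction to the step obligation

[OURS · L1 W5.2 · res-L1-w52-plan-1 RULING G12-5 (M0) / NOTE G12-7, hand res-L1-w52-stub-2 g6] The C-I pipeline (MONOMIAL PHASE →
CARRIER → CE1) starts, at a point `x` of the residual cosupport with NO local carrier (no residual stalk element of order one,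
res-L1-w52-idea-1 Sketch v16 §1 `HasLocalCarrierAt`), from a MEMBER HIT: the residual stalk lies in the ideal generated by the
members of the state through `x` (Sketch v16 §3 `HasMemberHitAt`, res-L1-w52-tri-1 RESULT 18:54:27Z (i)), so that a hitting
sub-family of members cuts out an snc stratum inside `cosupp K♭` through `x` — the centre of a monomial-phase move.  THE CLAUSE OF
RECORD (def-free, the two Sketch predicates inlined) is

  `MemberHit S cyl :⟺ ∀ x ∈ cosupp S.residual.K, x ∉ cyl.V → (¬ ∃ v ∈ K♭_x, v ∉ 𝔪_x²) → K♭_x ≤ ⨆_{T ∈ S.𝓔, x ∈ Supp T} T_x`,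

WITH the binder `x ∉ cyl.V` (this seat΄s QUESTION M0-1, 2026-08-27T19:2xZ): without it the clause fails at generation 1 for a
single rank-3 host (`I = (x₀x₁ − x₂²) + (x_k⁴)_k`, axis point `[0:0:0:1] ∈ E`: `K♭_x = (e₀e₁ − e₂², u²)`, no order-one element,
`⊄ (u)`); with it, generation 1 is vacuous (`cyl.V = ⊤` under `AtlasInitial`) and the content is the STEP CASE (order bookkeeping
under a v7 `StepStable` step, extraction lemma (EQ) of res-L1-w52-stub-1).  THIS FILE (part 1, fact-free):

* `ChainW52F7BetaRP.atlasInitial_memberHit` — generation 1: the clause is `AtlasInitial`-valid (vacuous at `cyl.V = ⊤`);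
* `ChainW52F7BetaRP.memberHit_of_reach_of_stepStable` — REDUCTION of (M0) to the step obligation: if the clause is step-stable
  (`StepStable MemberHit`, part 2, over (EQ)), it holds on every reachable cylinder state (`CylReach`, res-L1-w52-lead-1
  `…DepthPhaseCAtlasP`, inlined def-free as «every step-stable initially valid predicate holds»);
* `ChainW52F7BetaRP.memberHit_of_reach_of_stepStable_rel` — the RELATIVE form: it suffices that `P ∧ MemberHit` be step-stable
  for some initially valid auxiliary clause `P` (e.g. the order-bookkeeping invariant «hosts of residual order ≥ 2 carry the
  N-member monomial», tri-1 18:54:27Z (i)), the shape the step proof will use.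

Nothing here is a statement of the manuscript under review; AI-written, AI review weaker than expert review; counted 0.

## References

* J. Kollár, *Lectures on Resolution of Singularities* (2007), (3.111) Steps 1–3. [Kollar2007]
* E. Bierstone, D. Grigoriev, P. Milman, J. Włodarczyk, arXiv:1206.3090, Def. 3.1.3. [BierstoneGrigorievMilmanWlodarczyk2011]
-/

-- `Summit.<Summit>.<Sub>.Theorems` with `Sub = Summit` (single-conjunct summit, D-0017)
set_option linter.dupNamespace false

noncomputable section

open CategoryTheory AlgebraicGeometry TopologicalSpace IsLocalRing
open Literature.AlgebraicGeometry.Resolution Scheme.IdealSheafData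

namespace Summit.ResolutionOfSingularities.ResolutionOfSingularities.Theorems.ChainW52F7BetaRP

universe u

open DepthMultiHost

/-- [OURS · L1 W5.2] **Generation 1 of the member-hit clause**: the clause «off the cylinder region, every carrier-free point of
the residual cosupport is a member hit» is `AtlasInitial`-valid — at a generation-1 cylinder state the cylinder region is all
of `X` (`cyl.V = ⊤`), so there is no point off it. [cite: Kollar2007, (3.111) Step 1] -/
theorem atlasInitial_memberHit :
    AtlasInitial.{u} (fun X S cyl =>
      ∀ x ∈ (S.residual.K.support : Set X), x ∉ (cyl.V : Set X) →
        (¬ ∃ v ∈ stalkIdeal S.residual.K x, v ∉ (maximalIdeal (X.presheaf.stalk x)) ^ 2) →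
        stalkIdeal S.residual.K x ≤
          ⨆ (T : X.IdealSheafData) (_ : T ∈ S.𝓔 ∧ x ∈ (T.support : Set X)), stalkIdeal T x) := by
  intro X _ St cyl _ _ hV _ _ _ _ _ _ _ x _ hx
  exact (hx (by rw [hV]; trivial)).elim

/-- [OURS · L1 W5.2] **(M0) REDUCED TO THE STEP OBLIGATION**: if the member-hit clause is step-stable under the lifted cylinder step
of targets v7 (`StepStable`, with the CJS permissibility binders — the order bookkeeping over the extraction lemma (EQ), part 2),
then it holds on every REACHABLE cylinder state, i.e. on every `(S, cyl)` satisfying all step-stable initially valid predicates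
(`CylReach S cyl` of `…DepthPhaseCAtlasP`, written out). [cite: Kollar2007, (3.111) Steps 1–3] -/
theorem memberHit_of_reach_of_stepStable
    (hstep : StepStable.{u} (fun X S cyl =>
      ∀ x ∈ (S.residual.K.support : Set X), x ∉ (cyl.V : Set X) →
        (¬ ∃ v ∈ stalkIdeal S.residual.K x, v ∉ (maximalIdeal (X.presheaf.stalk x)) ^ 2) →
        stalkIdeal S.residual.K x ≤
          ⨆ (T : X.IdealSheafData) (_ : T ∈ S.𝓔 ∧ x ∈ (T.support : Set X)), stalkIdeal T x))
    {X : Scheme.{u}} (S : MultiHostState X) (cyl : CylState S)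
    (hreach : ∀ P : ∀ ⦃X : Scheme.{u}⦄ (S : MultiHostState X), CylState S → Prop,
      StepStable P → AtlasInitial P → P S cyl) :
    ∀ x ∈ (S.residual.K.support : Set X), x ∉ (cyl.V : Set X) →
      (¬ ∃ v ∈ stalkIdeal S.residual.K x, v ∉ (maximalIdeal (X.presheaf.stalk x)) ^ 2) →
      stalkIdeal S.residual.K x ≤
        ⨆ (T : X.IdealSheafData) (_ : T ∈ S.𝓔 ∧ x ∈ (T.support : Set X)), stalkIdeal T x :=
  hreach _ hstep atlasInitial_memberHit

/-- [OURS · L1 W5.2] **(M0), RELATIVE FORM**: to put the member-hit clause on every reachable cylinder state it suffices to find an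
initially valid auxiliary invariant `P` (the order bookkeeping: «a host of residual order ≥ 2 at a point keeps the N-member
monomial along the chain under it», res-L1-w52-tri-1 18:54:27Z (i)) such that `P ∧ MemberHit` is step-stable — the joint step may
use `P S cyl`. [cite: Kollar2007, (3.111) Steps 1–3] -/
theorem memberHit_of_reach_of_stepStable_rel
    {P : ∀ ⦃X : Scheme.{u}⦄ (S : MultiHostState X), CylState S → Prop} (hP₀ : AtlasInitial P)
    (hstep : StepStable.{u} (fun X S cyl => P S cyl ∧
      ∀ x ∈ (S.residual.K.support : Set X), x ∉ (cyl.V : Set X) →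
        (¬ ∃ v ∈ stalkIdeal S.residual.K x, v ∉ (maximalIdeal (X.presheaf.stalk x)) ^ 2) →
        stalkIdeal S.residual.K x ≤
          ⨆ (T : X.IdealSheafData) (_ : T ∈ S.𝓔 ∧ x ∈ (T.support : Set X)), stalkIdeal T x))
    {X : Scheme.{u}} (S : MultiHostState X) (cyl : CylState S)
    (hreach : ∀ P : ∀ ⦃X : Scheme.{u}⦄ (S : MultiHostState X), CylState S → Prop,
      StepStable P → AtlasInitial P → P S cyl) :
    ∀ x ∈ (S.residual.K.support : Set X), x ∉ (cyl.V : Set X) →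
      (¬ ∃ v ∈ stalkIdeal S.residual.K x, v ∉ (maximalIdeal (X.presheaf.stalk x)) ^ 2) →
      stalkIdeal S.residual.K x ≤
        ⨆ (T : X.IdealSheafData) (_ : T ∈ S.𝓔 ∧ x ∈ (T.support : Set X)), stalkIdeal T x :=
  (hreach _ hstep (fun _ _ St cyl _ _ hV hZreg hZexc hZdim h𝓔 hXexc hn hshape =>
    ⟨hP₀ St cyl hV hZreg hZexc hZdim h𝓔 hXexc hn hshape,
      atlasInitial_memberHit St cyl hV hZreg hZexc hZdim h𝓔 hXexc hn hshape⟩)).2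

/-- [OURS · L1 W5.2] **A member-pair cure is a member hit** (Sketch v16 §3, inlined): if two members through `x` already contain the
residual stalk in their sum, the member-hit conclusion holds at `x` — the K12 pole `K♭_x = (t a, t b, s²)` is of this kind.
[folklore] -/
theorem memberHit_of_pair {X : Scheme.{u}} (S : MultiHostState X) (x : X) {Ta Tb : X.IdealSheafData}
    (hTa : Ta ∈ S.𝓔) (hTb : Tb ∈ S.𝓔) (hxa : x ∈ (Ta.support : Set X)) (hxb : x ∈ (Tb.support : Set X))
    (hle : stalkIdeal S.residual.K x ≤ stalkIdeal Ta x ⊔ stalkIdeal Tb x) :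
    stalkIdeal S.residual.K x ≤
      ⨆ (T : X.IdealSheafData) (_ : T ∈ S.𝓔 ∧ x ∈ (T.support : Set X)), stalkIdeal T x := by
  refine le_trans hle (sup_le ?_ ?_)
  · exact le_iSup₂ (f := fun (T : X.IdealSheafData) (_ : T ∈ S.𝓔 ∧ x ∈ (T.support : Set X)) => stalkIdeal T x) Ta ⟨hTa, hxa⟩
  · exact le_iSup₂ (f := fun (T : X.IdealSheafData) (_ : T ∈ S.𝓔 ∧ x ∈ (T.support : Set X)) => stalkIdeal T x) Tb ⟨hTb, hxb⟩

/-- [OURS · L1 W5.2] **A member factor on every summand is a member hit**: if the residual stalk at `x` is contained in the stalk of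
ONE member through `x` (e.g. every residual summand keeps a positive exponent on that member), the member-hit conclusion holds.
[folklore] -/
theorem memberHit_of_le_member {X : Scheme.{u}} (S : MultiHostState X) (x : X) {T : X.IdealSheafData}
    (hT : T ∈ S.𝓔) (hx : x ∈ (T.support : Set X)) (hle : stalkIdeal S.residual.K x ≤ stalkIdeal T x) :
    stalkIdeal S.residual.K x ≤
      ⨆ (T : X.IdealSheafData) (_ : T ∈ S.𝓔 ∧ x ∈ (T.support : Set X)), stalkIdeal T x :=
  le_trans hle (le_iSup₂ (f := fun (T : X.IdealSheafData) (_ : T ∈ S.𝓔 ∧ x ∈ (T.support : Set X)) => stalkIdeal T x) T ⟨hT, hx⟩)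

end Summit.ResolutionOfSingularities.ResolutionOfSingularities.Theorems.ChainW52F7BetaRP

end
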